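import Literature.Combinatorics.Hypergraph.FGKMTProbabilisticCovering
import HarnessLib

/-!
# FGKMT probabilistic covering — deterministic selection by the first moment (PROVED)

Topic `Literature/Combinatorics/Hypergraph`. Source: K. Ford, B. Green, S. Konyagin, J. Maynard,
T. Tao, *Long gaps between primes*, J. Amer. Math. Soc. 31 (2018) 65–105 = arXiv:1412.5029, §4.2,
proof of Corollary 1 («in particular by linearity of expectation
`E #(V ∖ ⋃ 𝐞'_i) ≪ ∑_{v ∈ V} P_m(v)`. Thus we can find instances `e'_i` of `𝐞'_i` such that
`#(V ∖ ⋃ e'_i) ≪ ∑_{v ∈ V} P_m(v)`») and §4.3 (end of the proof of Theorem 2: «Taking a specific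
`n⃗' = n⃗'` for which this relation holds») [FordGreenKonyaginMaynardTao2018].

Everything here is PROVED (no new named facts). From the conclusion of Theorem 3
(`FGKMTCovering.Theorem3With C₀`, typed in `FGKMTProbabilisticCovering.lean`) with `A ≥ 2rm + 1`
we extract, by the first-moment method on the finite probability space `(ι → Finset V, Λ)`, a
DETERMINISTIC configuration `ω = (e'_i)_i` of edges, each empty or in the essential support of
`𝐞_i`, such that for any set `V' ⊆ V` of vertices the number of vertices of `V'` not covered by
`⋃_{j ≤ m} ⋃_{i ∈ I_j} e'_i` is at most `(1 + δ^{1/10^{m+1}}) ∑_{v ∈ V'} P_m(v)`. This is the form in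
which the covering theorem is consumed by the large-gaps argument (an UPPER bound for the sifted
set suffices for Theorem 2; the second-moment refinement `∼` of Corollary 3 is not needed there).

## Main statements

* `FGKMTCovering.exists_ne_zero_sum_mul_le` : averaging — a point of positive mass where `f ≤ E f`;
* `FGKMTCovering.exists_config_card_filter_le` : first-moment selection from a joint law;
* `FGKMTCovering.exists_config_of_theorem3With` : **Theorem 3 ⇒ deterministic covering**
  (Corollary 1-type conclusion, for every `V' ⊆ V`).
-/

noncomputable section

open Finset

namespace Literature.Combinatorics.Hypergraph

namespace FGKMTCovering

/-- **Averaging (first-moment method).** For a law `Λ` on a finite type and any real function `f`,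
some point of positive mass satisfies `f a ≤ E f = ∑_b Λ b f b`.
[cite: FordGreenKonyaginMaynardTao2018, §4.2 (proof of Corollary 1: «we can find instances»)] -/
theorem exists_ne_zero_sum_mul_le {α : Type*} [Fintype α] {Λ : α → ℝ} (hΛ : IsLaw Λ)
    (f : α → ℝ) : ∃ a, Λ a ≠ 0 ∧ f a ≤ ∑ b, Λ b * f b := by
  classical
  by_contra h
  push Not at h
  set E : ℝ := ∑ b, Λ b * f b with hE
  -- some point has positive mass
  have hex : ∃ a, Λ a ≠ 0 := by
    by_contra h0
    push Not at h0
    have h1 := hΛ.2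
    simp [h0] at h1
  obtain ⟨a₀, ha₀⟩ := hex
  have hlt : ∑ b, Λ b * E < ∑ b, Λ b * f b := by
    refine Finset.sum_lt_sum (fun b _ => ?_) ⟨a₀, Finset.mem_univ _, ?_⟩
    · by_cases hb : Λ b = 0
      · simp [hb]
      · exact mul_le_mul_of_nonneg_left (h b hb).le (hΛ.1 b)
    · exact mul_lt_mul_of_pos_left (h a₀ ha₀) (lt_of_le_of_ne (hΛ.1 a₀) (Ne.symm ha₀))
  rw [← Finset.sum_mul, hΛ.2, one_mul] at hlt
  exact lt_irrefl _ hlt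

/-- **First-moment selection.** Let `Λ` be a law on configurations `ω : ι → Finset V` such that every
vertex `v` is uncovered by the levels `1, …, m` with probability at most `(1 + ε) P v`. Then some
configuration of positive mass leaves at most `(1 + ε) ∑_{v ∈ V'} P v` vertices of `V'` uncovered
(linearity of expectation + averaging). [cite: FordGreenKonyaginMaynardTao2018, §4.2 (proof of Corollary 1)] -/
theorem exists_config_card_filter_le {V ι : Type*} [Fintype V] [DecidableEq V] [Fintype ι]
    [DecidableEq ι] {m : ℕ} {I : ℕ → Finset ι} {Λ : (ι → Finset V) → ℝ} {ε : ℝ} {P : V → ℝ}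
    (hΛ : IsLaw Λ)
    (hprob : ∀ v : V,
      ∑ ω ∈ (univ : Finset (ι → Finset V)).filter (fun ω => AvoidsLevels I m {v} ω), Λ ω ≤
        (1 + ε) * P v)
    (V' : Finset V) :
    ∃ ω : ι → Finset V, Λ ω ≠ 0 ∧
      ((V'.filter (fun v => AvoidsLevels I m {v} ω)).card : ℝ) ≤ (1 + ε) * ∑ v ∈ V', P v := by
  classical
  set f : (ι → Finset V) → ℝ := fun ω => ((V'.filter (fun v => AvoidsLevels I m {v} ω)).card : ℝ)
    with hf
  obtain ⟨ω, hω, hle⟩ := exists_ne_zero_sum_mul_le hΛ f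
  refine ⟨ω, hω, le_trans hle ?_⟩
  -- `E f = ∑_{v ∈ V'} P(v uncovered) ≤ (1 + ε) ∑ P v`
  have hfω : ∀ ω' : ι → Finset V,
      f ω' = ∑ v ∈ V', (if AvoidsLevels I m {v} ω' then (1 : ℝ) else 0) := by
    intro ω'
    simp only [hf]
    rw [Finset.card_filter]
    push_cast
    rfl
  calc ∑ b, Λ b * f b
      = ∑ b, ∑ v ∈ V', Λ b * (if AvoidsLevels I m {v} b then (1 : ℝ) else 0) := by
        refine Finset.sum_congr rfl fun b _ => ?_
        rw [hfω b, Finset.mul_sum]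
    _ = ∑ v ∈ V', ∑ b, Λ b * (if AvoidsLevels I m {v} b then (1 : ℝ) else 0) :=
        Finset.sum_comm
    _ = ∑ v ∈ V', ∑ b ∈ (univ : Finset (ι → Finset V)).filter (fun ω => AvoidsLevels I m {v} ω),
          Λ b := by
        refine Finset.sum_congr rfl fun v _ => ?_
        rw [Finset.sum_filter]
        refine Finset.sum_congr rfl fun b _ => ?_
        split_ifs <;> simp
    _ ≤ ∑ v ∈ V', (1 + ε) * P v := Finset.sum_le_sum fun v _ => hprob v
    _ = (1 + ε) * ∑ v ∈ V', P v := by rw [Finset.mul_sum]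

/-- **Theorem 3 ⇒ deterministic covering (Corollary 1-type conclusion).** Under the hypotheses of
Theorem 3 with `A ≥ 2rm + 1` (so that (b) applies to singletons `e = {v}` at `J = m`), there is a
DETERMINISTIC choice of edges `e'_i` (`i ∈ ⋃_j I_j`), each empty or attained by `𝐞_i` with positive
probability, such that for every `V' ⊆ V`,
`#{v ∈ V' : v ∉ ⋃_{j ≤ m} ⋃_{i ∈ I_j} e'_i} ≤ (1 + δ^{1/10^{m+1}}) ∑_{v ∈ V'} P_m(v)`.
[cite: FordGreenKonyaginMaynardTao2018, Corollary 1 (proof) and §4.3 (end of proof of Theorem 2)] -/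
theorem exists_config_of_theorem3With {C₀ : ℝ} (h : Theorem3With C₀)
    {V ι : Type} [Fintype V] [DecidableEq V] [Fintype ι] [DecidableEq ι]
    {D r A κ δ : ℝ} {m : ℕ} {I : ℕ → Finset ι} {μ : ι → Finset V → ℝ}
    (hD : 1 ≤ D) (hr : 1 ≤ r) (hA : 1 ≤ A) (hκ0 : 0 < κ) (hκ : κ ≤ 1 / 2) (hδ : 0 < δ)
    (hsmall : δ ≤ (κ ^ A / (C₀ * Real.exp (A * D))) ^ (10 ^ (m + 2) : ℕ))
    (hAm : 2 * r * m + 1 ≤ A)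
    (hne : ∀ j ∈ Finset.Icc 1 m, (I j).Nonempty)
    (hdisj : ∀ j₁ ∈ Finset.Icc 1 m, ∀ j₂ ∈ Finset.Icc 1 m, j₁ ≠ j₂ → Disjoint (I j₁) (I j₂))
    (hlaw : ∀ j ∈ Finset.Icc 1 m, ∀ i ∈ I j, IsLaw (μ i))
    (hsize : ∀ j ∈ Finset.Icc 1 m, ∀ i ∈ I j, ∀ S : Finset V, μ i S ≠ 0 → (S.card : ℝ) ≤ r)
    (hsparse : ∀ j ∈ Finset.Icc 1 m, ∀ i ∈ I j, ∀ v : V,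
        probMem (μ i) v ≤ δ / Real.sqrt ((I j).card : ℝ))
    (hcodeg : ∀ j ∈ Finset.Icc 1 m, ∀ v₁ v₂ : V, v₁ ≠ v₂ →
        ∑ i ∈ I j, probPairMem (μ i) v₁ v₂ ≤ δ)
    (hdeg : ∀ j ∈ Finset.Icc 1 m, ∀ v : V, normDegree μ (I j) v ≤ D * levelProb μ I (j - 1) v)
    (hκP : ∀ j ≤ m, ∀ v : V, κ ≤ levelProb μ I j v)
    (V' : Finset V) :
    ∃ ω : ι → Finset V, (∀ j ∈ Finset.Icc 1 m, ∀ i ∈ I j, ω i = ∅ ∨ μ i (ω i) ≠ 0) ∧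
      ((V'.filter (fun v => ∀ j ∈ (Finset.Icc 1 m : Finset ℕ), ∀ i ∈ I j, v ∉ ω i)).card : ℝ) ≤
        (1 + δ ^ (1 / (10 : ℝ) ^ (m + 1))) * ∑ v ∈ V', levelProb μ I m v := by
  obtain ⟨Λ, hΛ, hsupp, hb⟩ := h V ι D r A κ δ m I μ hD hr hA hκ0 hκ hδ hsmall hne hdisj hlaw
    hsize hsparse hcodeg hdeg hκP
  -- (b) at `J = m`, `e = {v}`: `P(v uncovered) ≤ (1 + δ^{1/10^{m+1}}) P_m(v)`
  have hprob : ∀ v : V,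
      ∑ ω ∈ (univ : Finset (ι → Finset V)).filter (fun ω => AvoidsLevels I m {v} ω), Λ ω ≤
        (1 + δ ^ (1 / (10 : ℝ) ^ (m + 1))) * levelProb μ I m v := by
    intro v
    have hcard : (({v} : Finset V).card : ℝ) ≤ A - 2 * r * m := by
      rw [Finset.card_singleton]; push_cast; linarith
    have h1 := hb m le_rfl {v} hcard
    have hset : levelProbSet μ I m {v} = levelProb μ I m v := by
      rw [levelProbSet, Finset.prod_singleton]
    rw [hset] at h1
    have h2 := (abs_le.1 h1).2
    linarith
  obtain ⟨ω, hω, hle⟩ := exists_config_card_filter_le (I := I) (m := m) hΛ hprob V'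
  refine ⟨ω, hsupp ω hω, ?_⟩
  have hfilter : V'.filter (fun v => ∀ j ∈ (Finset.Icc 1 m : Finset ℕ), ∀ i ∈ I j, v ∉ ω i) =
      V'.filter (fun v => AvoidsLevels I m {v} ω) := by
    ext v
    simp only [Finset.mem_filter, AvoidsLevels, Finset.mem_singleton, forall_eq]
  rw [hfilter]
  exact hle

end FGKMTCovering

end Literature.Combinatorics.Hypergraph
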